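import Summits.Ventures.PercRepro.ProfilePointedCircuitClassesTwelveCocircuitD
import Summits.Ventures.PercRepro.ProfilePointedCircuitClassesTwelveCaptureD
import Summits.Ventures.PercRepro.ProfilePointedCircuitClassesFiveSeriesMem
import Summits.Ventures.PercRepro.ProfilePointedCircuitClassesTwelveSeriesD
import Summits.Ventures.PercRepro.ProfilePointedCircuitClassesFourteenSeries
import Summits.Ventures.PercRepro.ProfilePointedCircuitClassesInOutFive

/-!
# PercRepro — THE COCIRCUIT REGIME, PART E: THE WRAPPER — ANY 3-COCIRCUIT `{a', e, p}` THROUGH A POINT OF A SERIES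
PAIR SETTLES `e`, WITH NO SIDE CONDITION (p5, gen 48; `proofs/P5-GM1.md` §71(e))

`inCount_five_le_outCount_six_of_cocircuit'`: on `#E = 12`, `ρ(E) = 7`, if `{a, a'}` is a series pair, `e, p` two
further points and `ρ(E − {a', e, p}) = 6` (the triple contains a cocircuit), then `in_5(e) ≤ out_6(e)`.  The side
conditions of part D are discharged by the kernel's degenerate-case theorems: `e` a loop (`_of_loop`), `e` or `p` a
coloop (`_of_twelve_of_coloop`), `{a', e}` or `{e, p}` a series pair (`_of_twelve_of_seriesPair_mem`), `{a', p}` a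
series pair — a series triple `{a, a', p}` (`_of_seriesTriple_all`), `e` parallel to `a` or `a'` (`_of_parallel`),
`{a, a', e}` a three-point line (`_of_line`), and the generic case (`_of_cocircuit`).  Note that `a ∥ a'` is
impossible here: it would make `{e, p}` contain a cocircuit, which is one of the listed cases.
-/

open scoped Matroid

namespace PercRepro.Cogirth

open Finset ThmH Skew Shadow Profile

variable {α : Type} [DecidableEq α] {N : Matroid α} [N.Finite]

section TwelveCocircuitE

/-- Two non-loops `x, y` with `ρ(E − x) = ρ(E − y) = ρ(E)` and `ρ(E − x − y) + 1 = ρ(E)` form a series pair. -/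
theorem seriesPair_of_rk {x y : α} (hx : x ∈ gr N) (hy : y ∈ gr N) (hxy : x ≠ y)
    (hcx : rk N ((gr N).erase x) = rk N (gr N)) (hcy : rk N ((gr N).erase y) = rk N (gr N))
    (h2 : rk N (((gr N).erase x).erase y) + 1 = rk N (gr N)) : SeriesPair N x y :=
  ⟨hx, hy, hxy, hcx, hcy, h2⟩

/-- **THE COCIRCUIT REGIME WITHOUT SIDE CONDITIONS**: `#E = 12`, `ρ(E) = 7`, `{a, a'}` a series pair, `e, p ∉ {a, a'}`
distinct, and `ρ(E − {a', e, p}) = 6`: then `in_5(e) ≤ out_6(e)`. -/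
theorem inCount_five_le_outCount_six_of_cocircuit' (hn : (gr N).card = 12) (hR : rk N (gr N) = 7) {a a' e p : α}
    (h : SeriesPair N a a') (he : e ∈ gr N) (hp : p ∈ gr N) (hea : e ≠ a) (hea' : e ≠ a') (hpa : p ≠ a)
    (hpa' : p ≠ a') (hep : e ≠ p) (hcoc : rk N ((((gr N).erase a').erase e).erase p) = 6) :
    inCount N 5 e ≤ outCount N 6 e := by
  have ha : a ∈ gr N := h.1
  have ha' : a' ∈ gr N := h.2.1
  have hne : a ≠ a' := h.2.2.1
  have hn5 : (gr N).card = rk N (gr N) + 5 := by omega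
  have hR7 : 7 ≤ rk N (gr N) := by omega
  -- `e` a loop
  by_cases hel : rk N {e} = 0
  · exact inCount_five_le_outCount_six_of_loop hel
  have hre : rk N {e} = 1 := by
    have h1 := rk_le_card (M := N) ({e} : Finset α)
    rw [card_singleton] at h1
    omega
  -- `e` a coloop
  by_cases hec : rk N ((gr N).erase e) < rk N (gr N)
  · exact inCount_five_le_outCount_six_of_twelve_of_coloop hn5 hR he hec he
  have hec' : rk N ((gr N).erase e) = 7 := by
    have := rk_mono' (M := N) (erase_subset e (gr N))
    omega
  -- `p` a coloop
  by_cases hpc : rk N ((gr N).erase p) < rk N (gr N)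
  · exact inCount_five_le_outCount_six_of_twelve_of_coloop hn5 hR hp hpc he
  have hpc' : rk N ((gr N).erase p) = 7 := by
    have := rk_mono' (M := N) (erase_subset p (gr N))
    omega
  have ha'c : rk N ((gr N).erase a') = 7 := by rw [h.2.2.2.2.1, hR]
  -- the three pairs: each of `E − {a', e}`, `E − {a', p}`, `E − {e, p}` has rank `6` or `7`
  have hsub1 : (((gr N).erase a').erase e).erase p ⊆ ((gr N).erase a').erase e := erase_subset _ _
  have hsub2 : (((gr N).erase a').erase e).erase p ⊆ ((gr N).erase a').erase p := by
    rw [erase_right_comm]; exact erase_subset _ _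
  have hsub3 : (((gr N).erase a').erase e).erase p ⊆ ((gr N).erase e).erase p := by
    intro x hx
    simp only [mem_erase] at hx ⊢
    exact ⟨hx.1, hx.2.1, hx.2.2.2⟩
  have h1lo := rk_mono' (M := N) hsub1
  have h2lo := rk_mono' (M := N) hsub2
  have h3lo := rk_mono' (M := N) hsub3
  have h1hi := rk_le_rk_erase_add_one (M := N) (erase_subset a' (gr N)) (mem_erase.2 ⟨hea', he⟩)
  have h2hi := rk_le_rk_erase_add_one (M := N) (erase_subset a' (gr N)) (mem_erase.2 ⟨hpa', hp⟩)
  have h3hi := rk_le_rk_erase_add_one (M := N) (erase_subset e (gr N)) (mem_erase.2 ⟨hep.symm, hp⟩)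
  have h1up := rk_mono' (M := N) ((erase_subset e ((gr N).erase a')).trans (erase_subset a' (gr N)))
  have h2up := rk_mono' (M := N) ((erase_subset p ((gr N).erase a')).trans (erase_subset a' (gr N)))
  have h3up := rk_mono' (M := N) ((erase_subset p ((gr N).erase e)).trans (erase_subset e (gr N)))
  -- `{a', e}` a series pair
  by_cases hc1 : rk N (((gr N).erase a').erase e) = 6
  · have hser : SeriesPair N e a' :=
      seriesPair_of_rk he ha' hea' (by rw [hec', hR]) (by rw [ha'c, hR]) (by rw [erase_right_comm, hc1, hR])
    exact inCount_five_le_outCount_six_of_twelve_of_seriesPair_mem hn hR hser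
  have hc1' : rk N (((gr N).erase a').erase e) = 7 := by omega
  -- `{a', p}` a series pair: the series triple `{a, a', p}`
  by_cases hc2 : rk N (((gr N).erase a').erase p) = 6
  · have hser : SeriesPair N a' p := seriesPair_of_rk ha' hp hpa'.symm (by rw [ha'c, hR]) (by rw [hpc', hR]) (by rw [hc2, hR])
    exact inCount_five_le_outCount_six_of_seriesTriple_all hn hR h hser hpa.symm he
  have hc2' : rk N (((gr N).erase a').erase p) = 7 := by omega
  -- `{e, p}` a series pair
  by_cases hc3 : rk N (((gr N).erase e).erase p) = 6
  · have hser : SeriesPair N e p := seriesPair_of_rk he hp hep (by rw [hec', hR]) (by rw [hpc', hR]) (by rw [hc3, hR])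
    exact inCount_five_le_outCount_six_of_twelve_of_seriesPair_mem hn hR hser
  have hc3' : rk N (((gr N).erase e).erase p) = 7 := by omega
  -- `e` parallel to `a` or to `a'`
  have hra : rk N {a} = 1 := rk_singleton_eq_one_of_seriesPair h
  have hra' : rk N {a'} = 1 := rk_singleton_eq_one_of_seriesPair h.symm
  by_cases hae1 : rk N {a, e} = 1
  · apply inCount_five_le_outCount_six_of_parallel hn5 hR7 hea he ha hre hra
    rw [mem_clF_iff_rk_insert_eq ha (singleton_subset_iff.2 he), hre]
    exact hae1
  by_cases ha'e1 : rk N {a', e} = 1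
  · apply inCount_five_le_outCount_six_of_parallel hn5 hR7 hea' he ha' hre hra'
    rw [mem_clF_iff_rk_insert_eq ha' (singleton_subset_iff.2 he), hre]
    exact ha'e1
  have hae2 : rk N {a, e} = 2 := by
    have h1 := rk_insert_le_add_one ha (singleton_subset_iff.2 he)
    have h2 := rk_mono' (M := N) (subset_insert a ({e} : Finset α))
    rw [hre] at h1 h2
    omega
  have ha'e2 : rk N {a', e} = 2 := by
    have h1 := rk_insert_le_add_one ha' (singleton_subset_iff.2 he)
    have h2 := rk_mono' (M := N) (subset_insert a' ({e} : Finset α))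
    rw [hre] at h1 h2
    omega
  -- `a ∥ a'` is impossible: then `E − {a', e, p}` and `E − {e, p}` would have the same rank
  have ha'a2 : rk N {a', a} = 2 := by
    by_contra hne2
    have h1 := rk_insert_le_add_one ha' (singleton_subset_iff.2 ha)
    have h2 := rk_mono' (M := N) (subset_insert a' ({a} : Finset α))
    rw [hra] at h1 h2
    have h11 : rk N {a', a} = 1 := by omega
    -- `a' ∈ cl{a} ⊆ cl(E − {a', e, p})`, so adding `a'` to `E − {a', e, p}` keeps the rank `6`
    have haH : a ∈ (((gr N).erase a').erase e).erase p :=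
      mem_erase.2 ⟨hpa.symm, mem_erase.2 ⟨hea.symm, mem_erase.2 ⟨hne, ha⟩⟩⟩
    have hHg : (((gr N).erase a').erase e).erase p ⊆ gr N :=
      (erase_subset _ _).trans ((erase_subset _ _).trans (erase_subset _ _))
    have hcl : a' ∈ clF N ((((gr N).erase a').erase e).erase p) := by
      have h3 : a' ∈ clF N ({a} : Finset α) := by
        rw [mem_clF_iff_rk_insert_eq ha' (singleton_subset_iff.2 ha), hra]
        exact h11
      exact clF_mono (M := N) (singleton_subset_iff.2 haH) h3
    rw [mem_clF_iff_rk_insert_eq ha' hHg, insert_erase_three_eq_erase_two ha' hea' hpa', hcoc] at hcl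
    omega
  -- the line `{a, a', e}` or the generic case
  by_cases htri : rk N {a, a', e} = 2
  · exact inCount_five_le_outCount_six_of_line hn hR h he hea hea' hae2 ha'a2 htri
  have hQ : rk N {a, a', e} = 3 := by
    have h1 := rk_insert_le_add_one ha (insert_subset ha' (singleton_subset_iff.2 he))
    have h2 := rk_mono' (M := N) (subset_insert a ({a', e} : Finset α))
    rw [ha'e2] at h1 h2
    omega
  exact inCount_five_le_outCount_six_of_cocircuit hn hR h he hp hea hea' hpa hpa' hep hcoc hc1' hc2' hc3' hQ

end TwelveCocircuitE

end PercRepro.Cogirth
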